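import Summits.MatrixMultiplication.MatrixMultiplication.Theorems.AsymptoticRankCWSkewPairRanges
import Summits.MatrixMultiplication.MatrixMultiplication.Theorems.AsymptoticRankCWBThesisSkewSplit
import Summits.MatrixMultiplication.MatrixMultiplication.Theorems.AsymptoticRankCWBStrictSubmult
import Literature.Computability.AlgebraicComplexity.KoszulFlatteningKronecker
import Literature.Computability.AlgebraicComplexity.BorderRankRestriction

/-!
# `R̃(ε ⊠ ε) < 17` strictly: the envelope of `stub_skewSquareNine` is `[9, 17)`
(route `MatrixMultiplication/AsymptoticRankCW`; crux `BDet3AsymptoticRank` =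
stmt-MatrixMultiplication-0591 = stub `stub_skewSquareNine` of the line `skew_anchor` of the crux
`BThesis` = stmt-MatrixMultiplication-0588; support item `BSkewDominatesCw` = stmt-18009)

`ε` = the route's inline Levi-Civita tensor (`≅ T_skewcw,2 = skewCwTensor ℂ 1`, `ε ⊠ ε ≅ det₃`).
The tree had `9 ≤ R̃(ε ⊠ ε) ≤ 17` (`nine_le_asymptoticRank_leviCivita_sq`,
`asymptoticRank_leviCivita_sq_le_seventeen`, from the certified `bR(det₃) ≤ 17`). Here the upper end
is made STRICT by the Alman–Li one-slice speedup in the tree's form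
`lt_of_algBorderRank_le_of_card_lt` (a universal spectral point is strictly below a border-rank bound
`r` that exceeds the format: `|ι| < r`, `|κ| + |μ| < r`), applied to the FOURTH Kronecker power:
`bR(T_skewcw,2^{⊗4}) ≤ bR(T_skewcw,2^{⊗2})² ≤ 17² = 289` while the fourth power lives in `(ℂ^81)^{⊗3}`
with `81 < 289` and `162 < 289` (the square itself, in `(ℂ^9)^{⊗3}` with `9 + 9 = 18 ≥ 17`, does not
qualify). Hence `F(T_skewcw,2)⁴ < 289` for the spectral point attaining `R̃` (Strassen duality), i.e.

* `asymptoticRank_skewCwTensor_one_sq_lt_seventeen : R̃(T_skewcw,2)² < 17`,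
* `asymptoticRank_leviCivita_sq_lt_seventeen : R̃(ε ⊠ ε) < 17` (**`R̃(det₃) < bR(det₃) = 17`**: the
  asymptotic rank of the `3 × 3` determinant tensor is strictly below its border rank),
* `asymptoticRank_leviCivita_lt_sqrt_seventeen : R̃(ε) < √17`,
* `asymptoticRank_leviCivita_sq_mem_Ico : R̃(ε ⊠ ε) ∈ [9, 17)`.

So `stub_skewSquareNine` asserts that a number in `[9, 17)` equals `9`, and the right-hand side of
`BSkewDominatesCw` lies in `[3, √17)`.

References: J. Alman, B. Li, arXiv:2605.21738 (2026), Thm. 6.1 / Cor. 6.1 ("if `bR(T) ≤ r` and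
`r > n` then `R̃(T) < r`"); A. Conner, F. Gesmundo, J. M. Landsberg, E. Ventura, comput. complexity
31 (2022) = arXiv:1909.04785, §1.3, Lemma 2.4; A. Conner, H. Huang, J. M. Landsberg,
arXiv:2009.11391, §8.
-/

set_option linter.dupNamespace false

noncomputable section

namespace Summit.MatrixMultiplication.MatrixMultiplication.Theorems

open Literature.Computability.AlgebraicComplexity

/-- **`R̃(T_skewcw,2)² < 17`**: the spectral point `F` attaining `R̃(T_skewcw,2)` (Strassen duality)
has `F(T_skewcw,2)⁴ = F(T_skewcw,2^{⊗4}) < 289`, since `bR(T_skewcw,2^{⊗4}) ≤ 17² = 289` and the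
fourth power has format `81 × 81 × 81` with `81 < 289`, `81 + 81 < 289`. [cite: AlmanLi2026, Cor. 6.1] -/
theorem asymptoticRank_skewCwTensor_one_sq_lt_seventeen :
    asymptoticRank (skewCwTensor ℂ 1) ^ 2 < 17 := by
  obtain ⟨F, hF, hFt⟩ := (strassen_duality_asymptoticRank_holds ℂ (skewCwTensor ℂ 1)).2
  rw [← hFt]
  have h17 : algBorderRank (kroneckerPow (skewCwTensor ℂ 1) 2) ≤ 17 :=
    CGLV2022_borderRank_skewCw2_sq_le_holds
  have hbR : algBorderRank (kroneckerPow (skewCwTensor ℂ 1) 4) ≤ 289 := by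
    rw [show (4 : ℕ) = 2 + 2 from rfl, algBorderRank_kroneckerPow_add]
    refine (algBorderRank_kroneckerTensor_le _ _).trans ?_
    calc algBorderRank (kroneckerPow (skewCwTensor ℂ 1) 2) *
          algBorderRank (kroneckerPow (skewCwTensor ℂ 1) 2) ≤ 17 * 17 := Nat.mul_le_mul h17 h17
      _ = 289 := by norm_num
  have h4 : F (kroneckerPow (skewCwTensor ℂ 1) 4) < (289 : ℕ) :=
    lt_of_algBorderRank_le_of_card_lt hF _ hbR (by simp) (by simp)
  rw [hF.map_kroneckerPow] at h4
  have h0 : 0 ≤ F (skewCwTensor ℂ 1) := hF.nonneg _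
  by_contra hnot
  have hsq : (17 : ℝ) ≤ F (skewCwTensor ℂ 1) ^ 2 := not_lt.1 hnot
  have h289 : (17 : ℝ) ^ 2 ≤ (F (skewCwTensor ℂ 1) ^ 2) ^ 2 := pow_le_pow_left₀ (by norm_num) hsq 2
  have hpow : (F (skewCwTensor ℂ 1) ^ 2) ^ 2 = F (skewCwTensor ℂ 1) ^ 4 := by ring
  push_cast at h4
  rw [hpow] at h289
  linarith

/-- **`R̃(ε ⊠ ε) < 17`**, i.e. `R̃(det₃) < bR(det₃) = 17`: `R̃(ε ⊠ ε) = R̃(ε)² = R̃(T_skewcw,2)² < 17`.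
[cite: AlmanLi2026, Cor. 6.1] -/
theorem asymptoticRank_leviCivita_sq_lt_seventeen :
    asymptoticRank (kroneckerTensor
        (fun a b c : Fin 3 => (if b = a + 1 ∧ c = a + 2 then (1 : ℂ) else 0) -
          (if b = a + 2 ∧ c = a + 1 then 1 else 0))
        (fun a b c : Fin 3 => (if b = a + 1 ∧ c = a + 2 then (1 : ℂ) else 0) -
          (if b = a + 2 ∧ c = a + 1 then 1 else 0))) < 17 := by
  rw [asymptoticRank_leviCivita_sq_eq_sq, asymptoticRank_leviCivita_eq_skewCwTensor]
  exact asymptoticRank_skewCwTensor_one_sq_lt_seventeen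

/-- **`R̃(ε) < √17`** (`≈ 4.123`). [cite: AlmanLi2026, Cor. 6.1] -/
theorem asymptoticRank_leviCivita_lt_sqrt_seventeen :
    asymptoticRank (fun a b c : Fin 3 => (if b = a + 1 ∧ c = a + 2 then (1 : ℂ) else 0) -
        (if b = a + 2 ∧ c = a + 1 then 1 else 0)) < Real.sqrt 17 := by
  refine Real.lt_sqrt_of_sq_lt ?_
  rw [← asymptoticRank_leviCivita_sq_eq_sq]
  exact asymptoticRank_leviCivita_sq_lt_seventeen

/-- **The envelope of `stub_skewSquareNine` / crux 0591**: `R̃(ε ⊠ ε) ∈ [9, 17)` — the stub asserts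
that this number is `9`. [cite: ConnerGesmundoLandsbergVentura2022, §2.3] -/
theorem asymptoticRank_leviCivita_sq_mem_Ico :
    asymptoticRank (kroneckerTensor
        (fun a b c : Fin 3 => (if b = a + 1 ∧ c = a + 2 then (1 : ℂ) else 0) -
          (if b = a + 2 ∧ c = a + 1 then 1 else 0))
        (fun a b c : Fin 3 => (if b = a + 1 ∧ c = a + 2 then (1 : ℂ) else 0) -
          (if b = a + 2 ∧ c = a + 1 then 1 else 0))) ∈ Set.Ico (9 : ℝ) 17 :=
  ⟨nine_le_asymptoticRank_leviCivita_sq, asymptoticRank_leviCivita_sq_lt_seventeen⟩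

/-- The right-hand side of `BSkewDominatesCw`: `R̃(ε) ∈ [3, √17)`. [cite: ConnerGesmundoLandsbergVentura2022, §2.2] -/
theorem asymptoticRank_leviCivita_mem_Ico :
    asymptoticRank (fun a b c : Fin 3 => (if b = a + 1 ∧ c = a + 2 then (1 : ℂ) else 0) -
        (if b = a + 2 ∧ c = a + 1 then 1 else 0)) ∈ Set.Ico (3 : ℝ) (Real.sqrt 17) :=
  ⟨three_le_asymptoticRank_leviCivita, asymptoticRank_leviCivita_lt_sqrt_seventeen⟩

end Summit.MatrixMultiplication.MatrixMultiplication.Theorems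

end
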